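import Mathlib.Data.Rat.Defs
import Mathlib.Data.Finset.Basic
import Mathlib.Tactic.Linarith
import Mathlib.Tactic.NormNum
import Mathlib.Tactic.IntervalCases
import Mathlib.Tactic.Positivity
import HarnessLib

/-!
# Weight arithmetic on the window `ρ ∈ (1/28, 1/24]` at `p = 5` (T31: the configuration table of Θ(xxi))

Uniform value line: INSTRUMENT — kernel-checked WEIGHT ARITHMETIC for the polynomial
weighted-centre model `W(f)` of the cell (engine 1's toy model: THEOREM-FS-eng1-g35 §10.3 LEMMA
4♭′(5) (a)–(b), §10.5 THEOREM Θ(xxi) configuration table; executable specification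
`code/eng1g35/p5win35.py` PART A–B; CARVER-NOTES-eng1-g35 T31) — NOT a resolution theorem, NOT a
statement about the Abramovich–Temkin–Włodarczyk invariant, NOT summit progress; AI-written Lean,
AI review is weaker than expert review.

## Dictionary (genuine weights, rationals; `p = 5`)

* legal slot weights: `Legal w := (0 < w ∧ w ≤ 1/5) ∨ w ∈ U`, `U = {5/24, 2/9, 1/4, 1/3, 1/2}`
  (LEMMA G: `N, N', W, M, V`); "dense" = the first alternative.
* configuration `(j⋆, j⋆⋆) = (3, 4)`: `ω₃ = 1 − 15ρ`, `ω₄ = 1 − 20ρ` (weight of `K₁`), channel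
  weight `w_x = ω₃ − 4ρ = 1 − 19ρ`; pure class of degree `j` has weight `jρ`.

## Content (p5win35 PART A–B, re-derived here)

* `legal_omega4_iff`: on `(1/28, 1/24)`, `ω₄ = 1 − 20ρ` is legal iff `ρ ≥ 1/25` (dense) or
  `ρ ∈ {19/480, 7/180, 3/80}` (`ω₄ = N, N', W`).
* `legal_channel_iff`: on `(1/29, 1/24]`, `1 − 19ρ` is legal iff `ρ ∈ {1/24, 7/171, 3/76, 2/57}`
  (`= N, N', W, M`; never dense).
* `pureDegree_dense_iff`: on `(1/28, 1/24]`, `jρ` is a dense legal weight iff `1 ≤ j ≤ 4`, or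
  `j = 5 ∧ ρ ≤ 1/25`.
* `pureDegree_mem_U_iff`: on `[1/28, 1/24]`, `j ≥ 3`, `jρ ∈ U` iff `(ρ, j) ∈ {(1/24; 5, 6, 8, 12),
  (1/27; 6, 9), (1/26; 13), (1/28; 7, 14)}` — PART A's special points inside the window.
* `K1_linear_iff`, `pairs_heavier_than_omega4_iff`: the two linear side conditions of PART B
  (`1 − 23ρ < 3ρ ↔ ρ > 1/26`; `8ρ > ω₄ ↔ ρ > 1/28`).

References (context only; elementary arithmetic decided here): [AbramovichTemkinWlodarczyk2024] §5
(weights of a weighted centre); [Wlodarczyk2022] (weighted centres in arbitrary characteristic).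
-/

namespace Literature.AlgebraicGeometry.Resolution.WeightedBlowup

namespace Window5

/-- `U = {5/24, 2/9, 1/4, 1/3, 1/2}` (the legal weights above `1/5`, LEMMA G).
[cite: AbramovichTemkinWlodarczyk2024, §5] -/
def U : Finset ℚ := {5/24, 2/9, 1/4, 1/3, 1/2}

/-- Legal slot weights `(0, 1/5] ∪ U`. [cite: AbramovichTemkinWlodarczyk2024, §5] -/
def Legal (w : ℚ) : Prop := (0 < w ∧ w ≤ 1/5) ∨ w ∈ U

/-- `Legal` is decidable. [cite: AbramovichTemkinWlodarczyk2024, §5] -/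
instance instDecidablePredLegal : DecidablePred Legal :=
  fun _ => inferInstanceAs (Decidable (_ ∨ _))

/-- (derived here) [cite: AbramovichTemkinWlodarczyk2024, §5] -/
theorem mem_U {w : ℚ} : w ∈ U ↔ w = 5/24 ∨ w = 2/9 ∨ w = 1/4 ∨ w = 1/3 ∨ w = 1/2 := by
  simp [U]

/-- **PART B (ω₄).** On the open window `(1/28, 1/24)`: `ω₄ = 1 − 20ρ` is legal iff `ρ ≥ 1/25`
(dense, `ω₄ ≤ 1/5`) or `ρ ∈ {19/480, 7/180, 3/80}` (`ω₄ = 5/24, 2/9, 1/4`; the values `1/30`,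
`1/40` giving `1/3`, `1/2` lie outside the window) (derived here).
[cite: AbramovichTemkinWlodarczyk2024, §5] -/
theorem legal_omega4_iff (ρ : ℚ) (h1 : 1/28 < ρ) (h2 : ρ < 1/24) :
    Legal (1 - 20 * ρ) ↔ 1/25 ≤ ρ ∨ ρ = 19/480 ∨ ρ = 7/180 ∨ ρ = 3/80 := by
  constructor
  · rintro (⟨-, h⟩ | h)
    · left; linarith
    · rcases mem_U.mp h with h | h | h | h | h
      · right; left; linarith
      · right; right; left; linarith
      · right; right; right; linarith
      · exfalso; linarith
      · exfalso; linarith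
  · rintro (h | rfl | rfl | rfl)
    · left; constructor <;> linarith
    · right; norm_num [mem_U]
    · right; norm_num [mem_U]
    · right; norm_num [mem_U]

/-- **PART B (channel).** On `(1/29, 1/24]`: the channel weight `1 − 19ρ` is legal iff
`ρ ∈ {1/24, 7/171, 3/76, 2/57}` (`= 5/24, 2/9, 1/4, 1/3`); it is never dense there
(`1 − 19ρ ≤ 1/5 ⟺ ρ ≥ 4/95 > 1/24`), and `1/38` (`= 1/2`) lies below the window (derived here).
[cite: AbramovichTemkinWlodarczyk2024, §5] -/
theorem legal_channel_iff (ρ : ℚ) (h1 : 1/29 < ρ) (h2 : ρ ≤ 1/24) :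
    Legal (1 - 19 * ρ) ↔ ρ = 1/24 ∨ ρ = 7/171 ∨ ρ = 3/76 ∨ ρ = 2/57 := by
  constructor
  · rintro (⟨-, h⟩ | h)
    · exfalso; linarith
    · rcases mem_U.mp h with h | h | h | h | h
      · left; linarith
      · right; left; linarith
      · right; right; left; linarith
      · right; right; right; linarith
      · exfalso; linarith
  · rintro (rfl | rfl | rfl | rfl) <;> right <;> norm_num [mem_U]

/-- **PART A (dense pure degrees).** On `(1/28, 1/24]`: the pure class of degree `j` has a dense
legal weight (`0 < jρ ≤ 1/5`) iff `1 ≤ j ≤ 4`, or `j = 5` and `ρ ≤ 1/25` (derived here).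
[cite: AbramovichTemkinWlodarczyk2024, §5] -/
theorem pureDegree_dense_iff (ρ : ℚ) (h1 : 1/28 < ρ) (h2 : ρ ≤ 1/24) (j : ℕ) :
    (0 < (j : ℚ) * ρ ∧ (j : ℚ) * ρ ≤ 1/5) ↔ (1 ≤ j ∧ j ≤ 4) ∨ (j = 5 ∧ ρ ≤ 1/25) := by
  constructor
  · rintro ⟨hpos, hle⟩
    have hj1 : 1 ≤ j := by
      rcases Nat.eq_zero_or_pos j with rfl | hj
      · simp at hpos
      · exact hj
    have hj6 : (j : ℚ) < 6 := by
      by_contra hcon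
      rw [not_lt] at hcon
      nlinarith
    have hj5 : j < 6 := by exact_mod_cast hj6
    rcases (show j ≤ 4 ∨ j = 5 by omega) with hj | rfl
    · exact Or.inl ⟨hj1, hj⟩
    · right
      refine ⟨rfl, ?_⟩
      push_cast at hle
      linarith
  · rintro (⟨hj1, hj4⟩ | ⟨rfl, hρ⟩)
    · have hj1' : (1 : ℚ) ≤ j := by exact_mod_cast hj1
      have hj4' : (j : ℚ) ≤ 4 := by exact_mod_cast hj4
      constructor <;> nlinarith
    · push_cast
      constructor <;> linarith

/-- **PART A (the `U`-points of the window).** On the closed window `[1/28, 1/24]`, for a pure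
degree `j ≥ 3`: `jρ ∈ U` iff `(ρ; j) ∈ {(1/24; 5, 6, 8, 12), (1/27; 6, 9), (1/26; 13), (1/28; 7, 14)}`
— i.e. `ρ = u/j` with `u ∈ U` and `24u ≤ j ≤ 28u` (derived here; = p5win35 PART A restricted to
the window). [cite: AbramovichTemkinWlodarczyk2024, §5] -/
theorem pureDegree_mem_U_iff (ρ : ℚ) (h1 : 1/28 ≤ ρ) (h2 : ρ ≤ 1/24) (j : ℕ) (hj : 3 ≤ j) :
    (j : ℚ) * ρ ∈ U ↔
      (ρ = 1/24 ∧ (j = 5 ∨ j = 6 ∨ j = 8 ∨ j = 12)) ∨ (ρ = 1/27 ∧ (j = 6 ∨ j = 9)) ∨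
        (ρ = 1/26 ∧ j = 13) ∨ (ρ = 1/28 ∧ (j = 7 ∨ j = 14)) := by
  have hj0 : (0 : ℚ) < j := by exact_mod_cast (show 0 < j by omega)
  constructor
  · intro h
    rcases mem_U.mp h with h | h | h | h | h
    · -- `jρ = 5/24`: `5 ≤ j < 6`
      have hlo : (5 : ℚ) ≤ j := by nlinarith
      have hhi : (j : ℚ) < 6 := by nlinarith
      have hlo' : 5 ≤ j := by exact_mod_cast hlo
      have hhi' : j < 6 := by exact_mod_cast hhi
      obtain rfl : j = 5 := by omega
      left; exact ⟨by push_cast at h; linarith, Or.inl rfl⟩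
    · -- `jρ = 2/9`: `16/3 ≤ j ≤ 56/9`, so `j = 6`
      have hlo : (16/3 : ℚ) ≤ j := by nlinarith
      have hhi : (j : ℚ) ≤ 56/9 := by nlinarith
      have hlo' : 6 ≤ j := by
        have : (5 : ℚ) < j := by linarith
        have : 5 < j := by exact_mod_cast this
        omega
      have hhi' : j ≤ 6 := by
        have : (j : ℚ) < 7 := by linarith
        have : j < 7 := by exact_mod_cast this
        omega
      obtain rfl : j = 6 := by omega
      right; left; exact ⟨by push_cast at h; linarith, Or.inl rfl⟩
    · -- `jρ = 1/4`: `6 ≤ j ≤ 7`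
      have hlo : (6 : ℚ) ≤ j := by nlinarith
      have hhi : (j : ℚ) ≤ 7 := by nlinarith
      have hlo' : 6 ≤ j := by exact_mod_cast hlo
      have hhi' : j ≤ 7 := by exact_mod_cast hhi
      rcases (show j = 6 ∨ j = 7 by omega) with rfl | rfl
      · left; exact ⟨by push_cast at h; linarith, Or.inr (Or.inl rfl)⟩
      · right; right; right; exact ⟨by push_cast at h; linarith, Or.inl rfl⟩
    · -- `jρ = 1/3`: `8 ≤ j ≤ 28/3`
      have hlo : (8 : ℚ) ≤ j := by nlinarith
      have hhi : (j : ℚ) ≤ 28/3 := by nlinarith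
      have hlo' : 8 ≤ j := by exact_mod_cast hlo
      have hhi' : j ≤ 9 := by
        have : (j : ℚ) < 10 := by linarith
        have : j < 10 := by exact_mod_cast this
        omega
      rcases (show j = 8 ∨ j = 9 by omega) with rfl | rfl
      · left; exact ⟨by push_cast at h; linarith, Or.inr (Or.inr (Or.inl rfl))⟩
      · right; left; exact ⟨by push_cast at h; linarith, Or.inr rfl⟩
    · -- `jρ = 1/2`: `12 ≤ j ≤ 14`
      have hlo : (12 : ℚ) ≤ j := by nlinarith
      have hhi : (j : ℚ) ≤ 14 := by nlinarith
      have hlo' : 12 ≤ j := by exact_mod_cast hlo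
      have hhi' : j ≤ 14 := by exact_mod_cast hhi
      rcases (show j = 12 ∨ j = 13 ∨ j = 14 by omega) with rfl | rfl | rfl
      · left; exact ⟨by push_cast at h; linarith, Or.inr (Or.inr (Or.inr rfl))⟩
      · right; right; left; exact ⟨by push_cast at h; linarith, rfl⟩
      · right; right; right; exact ⟨by push_cast at h; linarith, Or.inr rfl⟩
  · rintro (⟨rfl, rfl | rfl | rfl | rfl⟩ | ⟨rfl, rfl | rfl⟩ | ⟨rfl, rfl⟩ | ⟨rfl, rfl | rfl⟩) <;>
      norm_num [mem_U]

/-- PART B side condition: `K₁` is linear (no monomial `y·x`, `x = ω₄ − 3ρ ≥ 3ρ` fails) iff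
`1 − 23ρ < 3ρ`, i.e. `ρ > 1/26` (derived here). [cite: AbramovichTemkinWlodarczyk2024, §5] -/
theorem K1_linear_iff (ρ : ℚ) : 1 - 23 * ρ < 3 * ρ ↔ 1/26 < ρ := by
  constructor <;> intro h <;> linarith

/-- PART B side condition: pairs of slots of weight `≥ 4ρ` are heavier than `ω₄ = 1 − 20ρ` iff
`ρ > 1/28` (derived here). [cite: AbramovichTemkinWlodarczyk2024, §5] -/
theorem pairs_heavier_than_omega4_iff (ρ : ℚ) : 1 - 20 * ρ < 8 * ρ ↔ 1/28 < ρ := by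
  constructor <;> intro h <;> linarith

end Window5

end Literature.AlgebraicGeometry.Resolution.WeightedBlowup
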